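import Summits.Schanuel.Schanuel.Theorems.SoloInformedX193DeepUnique
import Summits.Schanuel.Schanuel.Theorems.SoloInformedX193NoCheapDepth
import Summits.Schanuel.Schanuel.Theorems.SoloInformedX193Assign
import Summits.Schanuel.Schanuel.Theorems.SoloInformedX193Count

/-!
# X193 kernel line, layer A capstone: no service structure obeys the seven laws

Solo seat `solo-Schanuel-informed`, X193 kernel programme (design note
`work/s213/X193-KERNEL-DESIGN.md` §0/§3 and Amendment A11 (v); pen proof
`work/s194/X193-pen.md` §§2–7).  This file assembles the abstract half of THEOREM X193:
for an abstract service structure `D : SoloServiceData ι` (file F2 =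
`SoloInformedX193Service`) the seven primitive laws — well-formedness (WF), the budgets
(Bud), the service identity (Srv), the pair law (PAIR), the entry law (L1), the twist laws
(TW) and the finiteness law (FIN) — are contradictory in the X193 range of exponents
`β > 2`, `0 < σ ≤ 1`, `γ < σ`, `σ² < γ (β + σ)`, `ν = 1 + β - (σ - γ)` (equivalently
`ν > 1 + β - σβ/(β+σ)`, `soloX_threshold_iff` of file F1).  The proof is bookkeeping over
the landed files: no cheap depth (F4 = `SoloInformedX193NoCheapDepth`,
`noCheapDepth_of_laws`), deep-column uniqueness (F3 = `SoloInformedX193DeepUnique`,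
`exists_deepUnique_of_laws`), the cheap assignment they force at every large level (F6c =
`SoloInformedX193Assign`, `cheapAssignable_of_laws`, run with fares `λ = 1/2`, `η = 1/8`)
and the count refuting any cheap assignment (F7e = `SoloInformedX193Count`,
`noCheapAssignment`); the side conditions `γ > 0`, `ν > 2`, `1 + β < σ + ν` follow from the
range.  Layer B of the programme (files F8–F12) builds such a structure from a sequence
`R_n ∈ RoyAdditiveSmall ξ β σ 0 ν n`, conditionally on Roy's Proposition 3.1
(`Literature.NumberTheory.Transcendental.Roy2010.prop_3_1`), and concludes X193.
No sorries.
-/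

namespace Summit.Schanuel.Schanuel.Theorems

namespace SoloServiceData

variable {ι : Type*} (D : SoloServiceData ι)

/-- **X193, abstract layer** (DESIGN §0; the theorem called `soloX_noServiceStructure` in
DESIGN §3).  No abstract service structure satisfies (WF) with constant `c₀ ≥ 0`, (Bud) with
`b₁ ≥ 0`, (Srv), (PAIR) with `A₁ ≥ 0`, (L1) with `A₂ ≥ 0`, (TW) and (FIN) from a level `n₀`
on, in the range `β > 2`, `0 < σ ≤ 1`, `γ < σ`, `σ² < γ (β + σ)`, `ν + (σ - γ) = 1 + β`. -/
theorem false_of_laws {c₀ β b₁ σ ν γ A₁ A₂ : ℝ} {n₀ : ℕ} (hW : D ∈ wellFormed c₀)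
    (hc₀ : 0 ≤ c₀) (hB : D ∈ budgetLaw β b₁ n₀) (hS : D ∈ serviceLaw σ ν c₀ n₀)
    (hP : D ∈ pairLaw A₁) (hE : D ∈ entryLaw β σ ν A₂ n₀) (hT : D ∈ twistLaw)
    (hF : D ∈ finiteLaw) (hβ : 2 < β) (hσ : 0 < σ) (hσ1 : σ ≤ 1) (hγσ : γ < σ)
    (hthr : σ ^ 2 < γ * (β + σ)) (hν : ν + (σ - γ) = 1 + β) (hb₁ : 0 ≤ b₁)
    (hA₁ : 0 ≤ A₁) (hA₂ : 0 ≤ A₂) : False := by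
  classical
  -- exponent bookkeeping
  have hγ : 0 < γ := by nlinarith [sq_nonneg σ]
  have hν2 : 2 < ν := by linarith
  have hν1 : 1 < ν := by linarith
  have hgap : 1 + β < σ + ν := by linarith
  have hβ1 : (1 : ℝ) ≤ β := by linarith
  -- the derived hypothesis families
  obtain ⟨n₃, hN⟩ := D.noCheapDepth_of_laws hW hB hE hT hF hβ1 hν2 hgap hσ hσ1 hb₁ hA₂
  obtain ⟨n₄, hU⟩ := D.exists_deepUnique_of_laws hW hP hT hσ1 hA₁
  have hA₃ : (0 : ℝ) ≤ 2 + 9 * A₂ := by positivity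
  have hBnn : (0 : ℝ) ≤ 2 + 9 * A₁ := by positivity
  -- the cheap assignment at fares `λ = 1/2`, `η = 1/8`
  obtain ⟨n₆, h6⟩ := D.cheapAssignable_of_laws (lam := 1 / 2) (η := 1 / 8) hW hc₀ hB hS hP
    hN hU hβ hν1 hν hσ.le hσ1 (by norm_num) (by norm_num) (by norm_num) hb₁ hA₁ hA₃
  have hA₆ : (0 : ℝ) ≤
      (3 + 2 * b₁) / (1 - 1 / 2) + (3 + b₁) / (1 / 2) + (2 + b₁) / (1 / 8) := by
    have h1 : (0 : ℝ) ≤ (3 + 2 * b₁) / (1 - 1 / 2) := div_nonneg (by linarith) (by norm_num)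
    have h2 : (0 : ℝ) ≤ (3 + b₁) / (1 / 2) := div_nonneg (by linarith) (by norm_num)
    have h3 : (0 : ℝ) ≤ (2 + b₁) / (1 / 8) := div_nonneg (by linarith) (by norm_num)
    linarith
  -- the count
  exact D.noCheapAssignment (lam := 1 / 2) (η := 1 / 8) hW hB hE hβ hσ hσ1 hγσ hthr hν
    (by norm_num) (by norm_num) (by norm_num) hb₁ hBnn hA₂ hA₆ h6

end SoloServiceData

end Summit.Schanuel.Schanuel.Theorems
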